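import Mathlib
import Summits.ValiantsHypothesis.ValiantsHypothesis.Theorems.LacunarySymmetroidMatrixDescartesMonotoneExactEnds

/-!
# `MatrixDescartes` (stmt-ValiantsHypothesis-18050) — THE EXACT MONOTONE COUNT: a monotone signed word with a
# non-degenerate base has EXACTLY `ν(C₊₊) + π(C₋₋)` positive zeros counted with multiplicity

HONEST FRAMING.  Cell `pub-symmetroid`, seat `val-sym-mdr-p2` (gen 21); helper file `--supports` the crux
`Theses.LacunarySymmetroid.MatrixDescartes` (OPEN), NO closure claim; companion of `…OneSidedExact` (the case of no negative
columns: `Z₊ = ν(C)`), `…MonotoneIncoherence` (`Z₊ ≤ k`, positive type), `…MonotoneExactEnds` (end inertias of the word)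
and `…TwoBlockDominance`.  An EXACT COUNT on the MONOTONE sector (two-sided, all sizes, all exponents); nothing here bears
on the crux in its window, `stub_twoSided`, `DoorA26` / `DoorA34`, registers, or `VP ≠ VNP`.

THE THEOREM (`card_posRoots_multiset_eq_of_monotone`).  `B` real symmetric, `det B ≠ 0`, at exponent `e`; positive columns
`Uₚ` (weights `σₚⱼ > 0`, exponents `δₚⱼ > e`) and negative columns `Uₙ` (weights `σₙⱼ < 0`, exponents `δₙⱼ < e`), so that
`x^{−e}F(x)` is Loewner-increasing, `F = X^eB + Uₚ diag(σₚX^{δₚ}) Uₚᵀ + Uₙ diag(σₙX^{δₙ}) Uₙᵀ`.  Then the positive zeros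
of `det F` COUNTED WITH MULTIPLICITY number EXACTLY
`ν(UₚᵀB⁻¹Uₚ) + π(UₙᵀB⁻¹Uₙ)` — the negative index of the Gram matrix of the positive columns plus the positive index of the
Gram matrix of the negative columns; the CROSS block `UₚᵀB⁻¹Uₙ` does not enter.  Consequences: distinct roots
`card_posRoots_le_of_monotone_gram`; **STERILE ⟺ COHERENT** on the monotone sector (`posRoots_eq_zero_iff_of_monotone`:
no positive zero iff `ν(C₊₊) = 0 ∧ π(C₋₋) = 0`, i.e. `C₊₊ ⪰ 0` and `C₋₋ ⪯ 0` — the converse of the sign-coherent Gram law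
`…GramDualCoherent` there); the monotone incoherence law's `k = #columns outside a coherent core` is an upper bound of
this «incoherence index»; the one-sided rung `Z₊ = ν(C)` is the case `ρₙ = ∅`.
PROOF.  Every root is of positive type (`posType_of_monotone`), so the count is `ν(F(a)) − ν(F(b))` between a
non-singular scale `a` below and `b` above all positive roots (one-type window law
`Inertia.card_roots_Ioo_add_negIndex_eq_of_posType`); the end inertias `ν(F(a)) = ν(B) + π(C₋₋)`,
`ν(F(b)) = ν(B) − ν(C₊₊)` are `…MonotoneExactEnds`.

[folklore] (Sylvester's law of inertia along a monotone matrix family).  Axioms `propext`, `Classical.choice`,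
`Quot.sound`.  No definitions.
-/

-- layout Summits/ValiantsHypothesis/ValiantsHypothesis forces the duplicated namespace component
set_option linter.dupNamespace false

namespace Summit.ValiantsHypothesis.ValiantsHypothesis.Theorems.LacunarySymmetroidMatrixDescartes

open Polynomial Matrix Finset
open scoped BigOperators Topology

namespace GramDual

section MonotoneExact

variable {ι ρ ρₚ ρₙ : Type} [Fintype ι] [DecidableEq ι] [Fintype ρ] [DecidableEq ρ] [Fintype ρₚ] [DecidableEq ρₚ]
  [Fintype ρₙ] [DecidableEq ρₙ]

/-- the signed column part (file-local notation, as in `…GramDualSigned`) -/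
local notation3 (prettyPrint := false) "𝕊[" U ", " σ ", " δ "]" =>
  ((U : Matrix _ _ ℝ).map Polynomial.C
      * Matrix.diagonal (fun j => Polynomial.C ((σ : _ → ℝ) j) * (Polynomial.X : Polynomial ℝ) ^ (δ j : ℕ))
      * ((U : Matrix _ _ ℝ).map Polynomial.C)ᵀ)

/-! ## §4  THE EXACT MONOTONE COUNT -/

/-- **THE EXACT MONOTONE COUNT.**  `B` real symmetric with `det B ≠ 0` at exponent `e`; positive columns `Uₚ` (weights
`σₚ > 0`) at exponents `δₚ > e` and negative columns `Uₙ` (weights `σₙ < 0`) at exponents `δₙ < e` — a MONOTONE signed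
word (`x^{−e}F(x)` Loewner-increasing).  Then the positive zeros of
`det(X^eB + Uₚ diag(σₚX^{δₚ}) Uₚᵀ + Uₙ diag(σₙX^{δₙ}) Uₙᵀ)` counted WITH MULTIPLICITY number EXACTLY
`ν(UₚᵀB⁻¹Uₚ) + π(UₙᵀB⁻¹Uₙ)` — the negative index of the Gram matrix of the positive columns plus the positive index of
the Gram matrix of the negative columns (the CROSS Gram block is irrelevant). [folklore] -/
theorem card_posRoots_multiset_eq_of_monotone (B : Matrix ι ι ℝ) (hBs : B.IsSymm) (hBu : IsUnit B.det)
    (Uₚ : Matrix ι ρₚ ℝ) (Uₙ : Matrix ι ρₙ ℝ) (σₚ : ρₚ → ℝ) (σₙ : ρₙ → ℝ) (hσₚ : ∀ j, 0 < σₚ j)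
    (hσₙ : ∀ j, σₙ j < 0) (e : ℕ) (δₚ : ρₚ → ℕ) (δₙ : ρₙ → ℕ) (hδₚ : ∀ j, e < δₚ j) (hδₙ : ∀ j, δₙ j < e)
    (hCₚ : (Uₚᵀ * B⁻¹ * Uₚ).IsHermitian) (hCₙ : (Uₙᵀ * B⁻¹ * Uₙ).IsHermitian) :
    Multiset.card ((Matrix.det (((Polynomial.X : Polynomial ℝ) ^ e) • B.map Polynomial.C + 𝕊[Uₚ, σₚ, δₚ]
        + 𝕊[Uₙ, σₙ, δₙ])).roots.filter (fun t => 0 < t))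
      = Fintype.card {j // hCₚ.eigenvalues j < 0} + Fintype.card {j // 0 < hCₙ.eigenvalues j} := by
  classical
  have hB : B.IsHermitian := Inertia.isHermitian_of_isSymm hBs
  -- the juxtaposed column system and its option-pencil presentation
  rw [add_assoc, ← signedPart_fromCols, word_eq_optionPencil]
  set U := Matrix.fromCols Uₚ Uₙ with hUdef
  set σ : ρₚ ⊕ ρₙ → ℝ := Sum.elim σₚ σₙ with hσdef
  set δ : ρₚ ⊕ ρₙ → ℕ := Sum.elim δₚ δₙ with hδdef
  set Sopt := (fun o : Option (ρₚ ⊕ ρₙ) => Option.elim o B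
    (fun j => σ j • Matrix.vecMulVec (fun a => U a j) (fun a => U a j))) with hSopt
  set dopt := (fun o : Option (ρₚ ⊕ ρₙ) => Option.elim o e δ) with hdopt
  have hS : ∀ o, (Sopt o).IsSymm := isSymm_optionLetter hBs U σ
  set P := Matrix.det (∑ o : Option (ρₚ ⊕ ρₙ), ((Polynomial.X : Polynomial ℝ) ^ dopt o) • (Sopt o).map Polynomial.C)
    with hPdef
  have hmono : ∀ j, (0 < σ j ∧ e < δ j) ∨ (σ j < 0 ∧ δ j < e) := fun j => by
    cases j with
    | inl j => exact Or.inl ⟨hσₚ j, hδₚ j⟩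
    | inr j => exact Or.inr ⟨hσₙ j, hδₙ j⟩
  -- (i) small scales: `ν(F(x)) = ν(B) + π(C₋₋)`, non-singular
  obtain ⟨ε₀, hε₀, hε₀'⟩ := exists_negIndex_word_small hBs hBu Uₚ Uₙ hσₚ hσₙ e hδₚ hδₙ hB hCₙ
  -- (ii) large scales: `ν(F(x)) + ν(C₊₊) = ν(B)`, non-singular
  obtain ⟨N, hN, hN'⟩ := exists_negIndex_word_large hBs hBu Uₚ Uₙ hσₚ hσₙ e hδₚ hδₙ hB hCₚ
  -- evaluation of the option pencil is the evaluated word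
  have hdetF : ∀ x : ℝ, (∑ k, x ^ dopt k • Sopt k).det
      = (x ^ e • B + U * Matrix.diagonal (fun j => σ j * x ^ δ j) * Uᵀ).det := fun x => by
    rw [← eval_word_eq_optionPencil B U σ e δ x]
  by_cases hP0 : P = 0
  · exfalso
    have ha := (hε₀' (ε₀ / 2) (by positivity) (by linarith)).2
    apply ha
    rw [← hdetF, ← DefiniteMoments.eval_det_pencil, ← hPdef, hP0, Polynomial.eval_zero]
  set a : ℝ := ε₀ / 2 with hadef
  set b : ℝ := N + 1 + (P.roots.toFinset.sum fun t => |t|) with hbdef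
  have hapos : 0 < a := by rw [hadef]; positivity
  have hsumnn : 0 ≤ P.roots.toFinset.sum fun t => |t| := Finset.sum_nonneg fun t _ => abs_nonneg t
  have hNb : N ≤ b := by rw [hbdef]; linarith
  have hbpos : 0 < b := lt_of_lt_of_le hN hNb
  have hroot_lt_b : ∀ t ∈ P.roots, t < b := by
    intro t ht
    have hmem : t ∈ P.roots.toFinset := Multiset.mem_toFinset.2 ht
    have h1 : |t| ≤ P.roots.toFinset.sum fun t => |t| :=
      Finset.single_le_sum (f := fun t => |t|) (fun t _ => abs_nonneg t) hmem
    have h2 : t ≤ |t| := le_abs_self t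
    rw [hbdef]; linarith
  have hroot_ge : ∀ t ∈ P.roots, 0 < t → ε₀ ≤ t := by
    intro t ht hpos
    by_contra h
    push Not at h
    have hdet := (hε₀' t hpos h).2
    apply hdet
    rw [← hdetF, ← DefiniteMoments.eval_det_pencil, ← hPdef]
    exact (Polynomial.mem_roots hP0).1 ht
  -- the end indices, transported to the option-pencil presentation
  have hνx : ∀ x : ℝ, Fintype.card {j // (Inertia.isHermitian_pencil dopt Sopt hS x).eigenvalues j < 0}
      = Fintype.card {j // (isHermitian_eval_word hBs U σ e δ x).eigenvalues j < 0} := fun x =>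
    Inertia.negIndex_congr (Inertia.isHermitian_pencil dopt Sopt hS x) (isHermitian_eval_word hBs U σ e δ x)
      (eval_word_eq_optionPencil B U σ e δ x).symm
  rcases lt_or_ge a b with hab | hba
  swap
  · -- degenerate placement `b ≤ a < ε₀`: no positive roots, and `ν(C₊₊) + π(C₋₋) = 0`
    have hbε : b < ε₀ := lt_of_le_of_lt hba (by rw [hadef]; linarith)
    have hb1 := (hε₀' b hbpos hbε).1
    have hb2 := (hN' b hNb).1
    have hnone : P.roots.filter (fun t => 0 < t) = 0 := by
      refine Multiset.filter_eq_nil.2 fun t ht hpos => ?_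
      have h1 := hroot_ge t ht hpos
      have h2 := hroot_lt_b t ht
      linarith
    rw [hnone, Multiset.card_zero]
    omega
  have ha : (∑ k, a ^ dopt k • Sopt k).det ≠ 0 := by
    rw [hdetF]; exact (hε₀' a hapos (by rw [hadef]; linarith)).2
  have hb : (∑ k, b ^ dopt k • Sopt k).det ≠ 0 := by
    rw [hdetF]; exact (hN' b hNb).2
  -- (iii) one-type window law on `(a, b)`: every root is of positive type
  have hpos := posType_of_monotone B hBu U σ e δ hmono
  have hwin := (Inertia.card_roots_Ioo_add_negIndex_eq_of_posType dopt Sopt hS hab ha hb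
    (fun t hat _ hdet u hu hu0 => hpos t (lt_trans hapos hat) hdet u hu hu0)).1
  rw [← hPdef] at hwin
  -- all positive roots lie in `(a, b)`
  have hfilter : P.roots.filter (fun t => 0 < t) = P.roots.filter (fun t => a < t ∧ t < b) := by
    refine Multiset.filter_congr fun t ht => ⟨fun hpos' => ⟨?_, hroot_lt_b t ht⟩, fun h => lt_trans hapos h.1⟩
    have := hroot_ge t ht hpos'
    rw [hadef]; linarith
  rw [hfilter]
  have hνa := (hε₀' a hapos (by rw [hadef]; linarith)).1
  have hνb := (hN' b hNb).1
  rw [hνx a] at hwin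
  rw [hνx b] at hwin
  omega

/-- **The exact monotone count, distinct roots**: `Z₊ ≤ ν(UₚᵀB⁻¹Uₚ) + π(UₙᵀB⁻¹Uₙ)`. [folklore] -/
theorem card_posRoots_le_of_monotone_gram (B : Matrix ι ι ℝ) (hBs : B.IsSymm) (hBu : IsUnit B.det)
    (Uₚ : Matrix ι ρₚ ℝ) (Uₙ : Matrix ι ρₙ ℝ) (σₚ : ρₚ → ℝ) (σₙ : ρₙ → ℝ) (hσₚ : ∀ j, 0 < σₚ j)
    (hσₙ : ∀ j, σₙ j < 0) (e : ℕ) (δₚ : ρₚ → ℕ) (δₙ : ρₙ → ℕ) (hδₚ : ∀ j, e < δₚ j) (hδₙ : ∀ j, δₙ j < e)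
    (hCₚ : (Uₚᵀ * B⁻¹ * Uₚ).IsHermitian) (hCₙ : (Uₙᵀ * B⁻¹ * Uₙ).IsHermitian) :
    ((Matrix.det (((Polynomial.X : Polynomial ℝ) ^ e) • B.map Polynomial.C + 𝕊[Uₚ, σₚ, δₚ]
        + 𝕊[Uₙ, σₙ, δₙ])).roots.toFinset.filter (fun t => 0 < t)).card
      ≤ Fintype.card {j // hCₚ.eigenvalues j < 0} + Fintype.card {j // 0 < hCₙ.eigenvalues j} := by
  classical
  rw [← card_posRoots_multiset_eq_of_monotone B hBs hBu Uₚ Uₙ σₚ σₙ hσₚ hσₙ e δₚ δₙ hδₚ hδₙ hCₚ hCₙ,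
    ← Multiset.toFinset_filter]
  exact Multiset.toFinset_card_le _

/-- **STERILE ⟺ COHERENT on the monotone sector.**  A monotone word has NO positive zero iff the Gram matrix of its
positive columns is PSD and the Gram matrix of its negative columns is NSD (in index form: `ν(C₊₊) = 0 ∧ π(C₋₋) = 0`) —
the converse of the sign-coherent Gram law (`posRoots_base_eq_empty_of_coherent`) on this sector. [folklore] -/
theorem posRoots_eq_zero_iff_of_monotone (B : Matrix ι ι ℝ) (hBs : B.IsSymm) (hBu : IsUnit B.det)
    (Uₚ : Matrix ι ρₚ ℝ) (Uₙ : Matrix ι ρₙ ℝ) (σₚ : ρₚ → ℝ) (σₙ : ρₙ → ℝ) (hσₚ : ∀ j, 0 < σₚ j)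
    (hσₙ : ∀ j, σₙ j < 0) (e : ℕ) (δₚ : ρₚ → ℕ) (δₙ : ρₙ → ℕ) (hδₚ : ∀ j, e < δₚ j) (hδₙ : ∀ j, δₙ j < e)
    (hCₚ : (Uₚᵀ * B⁻¹ * Uₚ).IsHermitian) (hCₙ : (Uₙᵀ * B⁻¹ * Uₙ).IsHermitian) :
    (Matrix.det (((Polynomial.X : Polynomial ℝ) ^ e) • B.map Polynomial.C + 𝕊[Uₚ, σₚ, δₚ]
        + 𝕊[Uₙ, σₙ, δₙ])).roots.filter (fun t => 0 < t) = 0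
      ↔ Fintype.card {j // hCₚ.eigenvalues j < 0} = 0 ∧ Fintype.card {j // 0 < hCₙ.eigenvalues j} = 0 := by
  classical
  rw [← Multiset.card_eq_zero, card_posRoots_multiset_eq_of_monotone B hBs hBu Uₚ Uₙ σₚ σₙ hσₚ hσₙ e δₚ δₙ hδₚ
    hδₙ hCₚ hCₙ]
  omega

end MonotoneExact

end GramDual

end Summit.ValiantsHypothesis.ValiantsHypothesis.Theorems.LacunarySymmetroidMatrixDescartes
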